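import Mathlib
import Summits.ValiantsHypothesis.ValiantsHypothesis.Theses.FifoMatching
import Summits.ValiantsHypothesis.ValiantsHypothesis.Theorems.FifoMatchingGridCorShadowExpRung
import Summits.ValiantsHypothesis.ValiantsHypothesis.Theorems.FifoMatchingNNDivisionHardCorSandwich
import Literature.Computability.AlgebraicComplexity.NestFreeMatchingPoly
import HarnessLib

/-!
# Route FifoMatching — crux `NNDivisionHard` (stmt-ValiantsHypothesis-21181):
# the crux is its HYPER-DEGREE tier (cofactors of total degree `> 2^⌊n^{1/8}⌋`), by name

The landed exponential rung `GridCorShadow.expRung_holds` (item stmt-27406 `NNExpDegreeCofactorHard`,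
PROVED): eventually in `n`, every nonzero cofactor `h ∈ ℝ≥0[x]` of total degree `≤ 2^⌊n^{1/8}⌋`
(`⌊n^{1/8}⌋ := Nat.sqrt (Nat.sqrt (Nat.sqrt n))`) has `2^⌊n^{1/8}⌋ < L₊(NN_n · h)`.  Since every
quasi-polynomial `2^((log₂ n + c)^c)` is eventually below `2^⌊n^{1/8}⌋` (`polylog_le_root8`), the
crux `NNDivisionHard` («for all `c`, eventually every nonzero cofactor `h` has
`2^((log₂ n + c)^c) < L₊(NN_n · h) + L₊(h)`») is EQUIVALENT to its restriction to cofactors of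
total degree `> 2^⌊n^{1/8}⌋` — polynomials that are cheap only through repeated squaring:

* `nnDivisionHard_of_hyperDegree`, `hyperDegree_of_nnDivisionHard`, `nnDivisionHard_iff_hyperDegree`.

Honest framing: a by-name LOCALISATION of what is open in 21181 (the hyper-degree tier), not
progress on it; `NNDivisionHard`, `NNNotVP` and `VP ≠ VNP` stay OPEN (NOT proved).  No definitions,
no named facts.
-/

noncomputable section

-- Sub = Summit single-conjunct layout: the duplicated namespace component is mandated by the tree.
set_option linter.dupNamespace false

namespace Summit.ValiantsHypothesis.ValiantsHypothesis.Theorems.FifoMatching.NNDivisionHard.HyperDegree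

open MvPolynomial Literature.Computability.AlgebraicComplexity
open scoped NNReal

/-- **Quasi-polynomial exponents are eventually below `⌊n^{1/8}⌋`:** for every `c`, eventually
`(log₂ n + c)^c ≤ Nat.sqrt (Nat.sqrt (Nat.sqrt n))`. [folklore] -/
theorem polylog_le_root8 (c : ℕ) :
    ∃ n₀ : ℕ, ∀ n ≥ n₀, (Nat.log 2 n + c) ^ c ≤ Nat.sqrt (Nat.sqrt (Nat.sqrt n)) := by
  obtain ⟨h₀, hh₀⟩ := CorSandwich.polylog_lt_rpow_eventually c (c := 1 / 16) (by norm_num)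
  refine ⟨max h₀ (2 ^ 16), fun n hn => ?_⟩
  have hn0 : h₀ ≤ n := le_trans (le_max_left _ _) hn
  have hn16 : 2 ^ 16 ≤ n := le_trans (le_max_right _ _) hn
  set r := Nat.sqrt (Nat.sqrt (Nat.sqrt n)) with hr
  -- `(r + 1)^8 > n`
  have h1 : n < (Nat.sqrt n + 1) * (Nat.sqrt n + 1) := Nat.lt_succ_sqrt n
  have h2 : Nat.sqrt n < (Nat.sqrt (Nat.sqrt n) + 1) * (Nat.sqrt (Nat.sqrt n) + 1) :=
    Nat.lt_succ_sqrt _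
  have h3 : Nat.sqrt (Nat.sqrt n) < (r + 1) * (r + 1) := Nat.lt_succ_sqrt _
  have h4 : Nat.sqrt n + 1 ≤ (r + 1) ^ 4 := by
    calc Nat.sqrt n + 1 ≤ (Nat.sqrt (Nat.sqrt n) + 1) * (Nat.sqrt (Nat.sqrt n) + 1) := h2
      _ ≤ ((r + 1) * (r + 1)) * ((r + 1) * (r + 1)) := Nat.mul_le_mul h3 h3
      _ = (r + 1) ^ 4 := by ring
  have h5 : n < (r + 1) ^ 8 := by
    calc n < (Nat.sqrt n + 1) * (Nat.sqrt n + 1) := h1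
      _ ≤ (r + 1) ^ 4 * (r + 1) ^ 4 := Nat.mul_le_mul h4 h4
      _ = (r + 1) ^ 8 := by ring
  -- in `ℝ`: `(log₂ n + c)^c < n^{1/16}` and `2 n^{1/16} ≤ n^{1/8} < r + 1`
  have hP : (((Nat.log 2 n + c) ^ c : ℕ) : ℝ) < (n : ℝ) ^ (1 / 16 : ℝ) := hh₀ n hn0
  have hq0 : (0 : ℝ) ≤ (n : ℝ) ^ (1 / 16 : ℝ) := Real.rpow_nonneg (Nat.cast_nonneg n) _
  have hq16 : ((n : ℝ) ^ (1 / 16 : ℝ)) ^ 16 = (n : ℝ) := by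
    rw [← Real.rpow_natCast, ← Real.rpow_mul (Nat.cast_nonneg n)]
    norm_num
  have hq2 : (2 : ℝ) ≤ (n : ℝ) ^ (1 / 16 : ℝ) := by
    by_contra hlt
    push Not at hlt
    have h := pow_lt_pow_left₀ hlt hq0 (n := 16) (by norm_num)
    rw [hq16] at h
    have : ((2 ^ 16 : ℕ) : ℝ) ≤ n := by exact_mod_cast hn16
    push_cast at this
    linarith
  -- `n^{1/8} < r + 1`, as `(n^{1/16})^2 < r + 1`
  have hq8 : ((n : ℝ) ^ (1 / 16 : ℝ)) ^ 2 < (r : ℝ) + 1 := by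
    by_contra hle
    push Not at hle
    have h := pow_le_pow_left₀ (by positivity) hle 8
    rw [← pow_mul, show 2 * 8 = 16 by norm_num, hq16] at h
    have h5' : ((n : ℕ) : ℝ) < (((r + 1) ^ 8 : ℕ) : ℝ) := by exact_mod_cast h5
    push_cast at h5'
    linarith
  -- hence `2 (log₂ n + c)^c < r + 1`
  have hfin : 2 * (((Nat.log 2 n + c) ^ c : ℕ) : ℝ) < (r : ℝ) + 1 := by
    have : 2 * (n : ℝ) ^ (1 / 16 : ℝ) ≤ ((n : ℝ) ^ (1 / 16 : ℝ)) ^ 2 := by nlinarith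
    linarith
  have hnat : 2 * (Nat.log 2 n + c) ^ c < r + 1 := by exact_mod_cast hfin
  omega

/-- **The hyper-degree tier implies the crux `NNDivisionHard` (by name).**  If, for every `c`,
eventually every nonzero cofactor `h` of total degree `> 2^⌊n^{1/8}⌋` has
`2^((log₂ n + c)^c) < L₊(NN_n · h) + L₊(h)`, then `NNDivisionHard` holds: cofactors of total degree
`≤ 2^⌊n^{1/8}⌋` are dealt with by the landed exponential rung `GridCorShadow.expRung_holds` and
`polylog_le_root8`.  (The route decl's inlined `NN_n` is definitionally `nestFreeMatchingPoly n ℝ≥0`.)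
[folklore] -/
theorem nnDivisionHard_of_hyperDegree
    (H : ∀ c : ℕ, ∃ n₀ : ℕ, ∀ n ≥ n₀, ∀ h : MvPolynomial (Fin (2 * n) × Fin (2 * n)) ℝ≥0, h ≠ 0 →
      2 ^ Nat.sqrt (Nat.sqrt (Nat.sqrt n)) < h.totalDegree →
        2 ^ ((Nat.log 2 n + c) ^ c) < complexity (nestFreeMatchingPoly n ℝ≥0 * h) + complexity h) :
    Summit.ValiantsHypothesis.ValiantsHypothesis.Theses.FifoMatching.NNDivisionHard := by
  intro c
  obtain ⟨n₀, hn₀⟩ := H c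
  obtain ⟨n₁, hn₁⟩ := GridCorShadow.expRung_holds
  obtain ⟨n₂, hn₂⟩ := polylog_le_root8 c
  refine ⟨max n₀ (max n₁ n₂), fun n hn h hh => ?_⟩
  have hn0 : n₀ ≤ n := le_trans (le_max_left _ _) hn
  have hn1 : n₁ ≤ n := le_trans ((le_max_left _ _).trans (le_max_right _ _)) hn
  have hn2 : n₂ ≤ n := le_trans ((le_max_right _ _).trans (le_max_right _ _)) hn
  show 2 ^ ((Nat.log 2 n + c) ^ c) < complexity (nestFreeMatchingPoly n ℝ≥0 * h) + complexity h
  by_cases hd : h.totalDegree ≤ 2 ^ Nat.sqrt (Nat.sqrt (Nat.sqrt n))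
  · have h1 := hn₁ n hn1 h hh hd
    have h2 : 2 ^ ((Nat.log 2 n + c) ^ c) ≤ 2 ^ Nat.sqrt (Nat.sqrt (Nat.sqrt n)) :=
      Nat.pow_le_pow_right (by norm_num) (hn₂ n hn2)
    exact lt_of_le_of_lt h2 (lt_of_lt_of_le h1 (Nat.le_add_right _ _))
  · exact hn₀ n hn0 h hh (lt_of_not_ge hd)

/-- The converse (trivial): the crux implies its hyper-degree tier. [folklore] -/
theorem hyperDegree_of_nnDivisionHard
    (hN : Summit.ValiantsHypothesis.ValiantsHypothesis.Theses.FifoMatching.NNDivisionHard) :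
    ∀ c : ℕ, ∃ n₀ : ℕ, ∀ n ≥ n₀, ∀ h : MvPolynomial (Fin (2 * n) × Fin (2 * n)) ℝ≥0, h ≠ 0 →
      2 ^ Nat.sqrt (Nat.sqrt (Nat.sqrt n)) < h.totalDegree →
        2 ^ ((Nat.log 2 n + c) ^ c) < complexity (nestFreeMatchingPoly n ℝ≥0 * h) + complexity h := by
  intro c
  obtain ⟨n₀, hn₀⟩ := hN c
  exact ⟨n₀, fun n hn h hh _ => hn₀ n hn h hh⟩

/-- **`NNDivisionHard` ⟺ its hyper-degree tier.**  What is OPEN in stmt-ValiantsHypothesis-21181 is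
exactly: quasi-polynomial monotone certificates `L₊(NN_n · h) + L₊(h)` with cofactors `h` of total
degree `> 2^⌊n^{1/8}⌋`. [folklore] -/
theorem nnDivisionHard_iff_hyperDegree :
    Summit.ValiantsHypothesis.ValiantsHypothesis.Theses.FifoMatching.NNDivisionHard ↔
    ∀ c : ℕ, ∃ n₀ : ℕ, ∀ n ≥ n₀, ∀ h : MvPolynomial (Fin (2 * n) × Fin (2 * n)) ℝ≥0, h ≠ 0 →
      2 ^ Nat.sqrt (Nat.sqrt (Nat.sqrt n)) < h.totalDegree →
        2 ^ ((Nat.log 2 n + c) ^ c) < complexity (nestFreeMatchingPoly n ℝ≥0 * h) + complexity h :=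
  ⟨hyperDegree_of_nnDivisionHard, nnDivisionHard_of_hyperDegree⟩

end Summit.ValiantsHypothesis.ValiantsHypothesis.Theorems.FifoMatching.NNDivisionHard.HyperDegree

end
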